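import Summits.QuantumFields.YangMills.Theorems.ContractibleFibreFibreAnchorTracePackaging
import Summits.QuantumFields.YangMills.Theorems.ContractibleFibreFibreAnchorVdrPlanar

/-!
# `PlanarAnchor` — the planar member `M = 0` of the fixed-width free-tube anchor, PROVED

Route `ContractibleFibre` of `QuantumFields/YangMills`, support item `PlanarAnchor` (stmt-QuantumFields-16245): with a
one-point fibre the free tube is two-dimensional lattice Yang–Mills in the faithful unitary representation `r` on the
torus `(ℤ/L)²` (plus decoupled dangling links), and all bounded measurable time-slab observables cluster in time at a
β-uniform rate once `L ≥ L_min(β)`.  Proof = the line `trace-vdr` of crux `FibreAnchor` run at `M = 0`, entirely through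
landed theorems: vacuum dominance with a rate for the planar partition functions
(`Cruxes.FibreAnchor.TraceVDR.stub_vdrPlanar`, p165809 — Jentzsch gap of the class-averaged one-plaquette kernel, no
Peter–Weyl) fed to the time-slicing / trace-formula packaging (`Cruxes.FibreAnchor.TraceVDR.stub_tracePackaging`,
p162988, which consumes the abstract trace-domination clustering theorem `stub_traceFormulaClustering`, p162688).
Constants: threshold `β₀ = 0`, rate `m₀ = 1/2` (VDR rate `1`), `C(β, w)`, `L_min(β, w)` from the two theorems.
-/

namespace Summit.QuantumFields.YangMills.Theorems

open Summit.QuantumFields.YangMills.Theses.ContractibleFibre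

/-- **`PlanarAnchor` holds** (route `ContractibleFibre`, item stmt-QuantumFields-16245): for every compact simple `G` and
faithful unitary `r` there are `β₀ = 0` and the β-uniform rate `m₀ = 1/2` such that for all `β ≥ β₀` and every slab width
`w` there are `C`, `L_min` with: on every width-0 free tube `(ℤ/L)² × Fin 1²`, `L ≥ L_min`, every pair of bounded measurable
`[c, c+w]`-time-slab observables satisfies `|E[F₁·F₂∘σ_n] − E[F₁]E[F₂∘σ_n]| ≤ C e^{−m₀ n}` for `2n < L`.  Composition of the
landed planar vacuum-dominance theorem (VDR at rate `1`, any `β ≥ 0`) with the landed packaging theorem (rate halves). -/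
theorem planarAnchor_proof : PlanarAnchor := by
  intro G _ _ _ _ hG r Tube
  refine ⟨0, 1 / 2, by norm_num, fun β hβ w => ?_⟩
  obtain ⟨C, Lmin, hV⟩ := Cruxes.FibreAnchor.TraceVDR.stub_vdrPlanar G hG r 1 one_pos β hβ
  exact Cruxes.FibreAnchor.TraceVDR.stub_tracePackaging G hG r 0 β 1 C Lmin hβ one_pos hV w

end Summit.QuantumFields.YangMills.Theorems
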